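import Mathlib
import Summits.ResolutionOfSingularities.ResolutionOfSingularities.Theorems.RadicialJungCleanModelsLens5TFrameGradedInf
import HarnessLib

/-!
# Route `RadicialJung`, crux `CleanModels` (stmt-15917): T″ port part 4/10 — §E∞ two-field M-side, part 1 (base-change lemmas, twist subfields, model-side obligations)

PORT (line lead `res-B-lead-1` g8, for Sketch rev 33) of res-B-lens-5's crux workfiles `Cruxes/DescentPerfectToAll/Lens5_TPrimeInfCurrency.lean` rev 4
(crux 75ffdaa75b27; author res-B-lens-5 g14), the T″ theorem module prepared by the author from `Lens5_TPrimeInf.lean` rev 3 (HOME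
`B/res-B-lens-5/g14/PORTALPHA_TPrimeInf_theorem_module.lean`, sha16 48c5cb0bf6ec7b34, certified by the author's one-file simulation) and
`Cruxes/DescentPerfectToAll/Lens5_TPrimeConst.lean` rev 1 (4e5e6a0028c2): THEOREMS T′_∞ / T″ / T‴ — the slice {`[Γ:pΓ] = p²`, `K/k′` separably
generated and `κ_v/k′` SEPARABLE for some finite intermediate field of constants `k ⊆ k′ ⊆ K`} of the research stub `stub_cleanLU3DefectNonDiscrete`
(grounds of ARBITRARY, possibly infinite, `p`-rank), modulo F-02 `CossartPiltant2019` and F-32 (`hEmb`) only.  Continues the T⁗-family port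
(`…Lens5TFrame{Currency,…,PDegreeC}`): same namespace `Summit.ResolutionOfSingularities.ResolutionOfSingularities.Theorems.RadicialJungCleanModels.Lens5TFrame`,
declarations VERBATIM; the authors' copies of §B/§B′ (defs) and §C/§D (RG/IR lemmas) are NOT repeated — they are the landed `…Lens5TFrameCurrency` /
`…Lens5TFrameRG` / `…Lens5TFrameIR` declarations of the same names and statements; §C′/§B‴ (unused bridges) and the T′_fin/T′₁/«T″ ⊇ T» corollaries are not ported.
OURS · counted 0 · nothing here proves resolution in characteristic `p`.


-/

set_option linter.dupNamespace false -- mandated namespace of this single-conjunct summit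

noncomputable section

section

open IsLocalRing
open Literature.AlgebraicGeometry.Resolution
open Summit.ResolutionOfSingularities.ResolutionOfSingularities.Theorems.RadicialJung.CleanModels
open Summit.ResolutionOfSingularities.ResolutionOfSingularities.Theorems.RadicialJung.CleanModels.Lens5
open Summit.ResolutionOfSingularities.ResolutionOfSingularities.Theorems.RadicialJung.CleanModels.Lens5.PRankTwoCurrency
open Summit.ResolutionOfSingularities.ResolutionOfSingularities.Theorems.RadicialJung.CleanModels.Lens5.PRankTwoAssembly
open Summit.ResolutionOfSingularities.ResolutionOfSingularities.Theorems.RadicialJungCleanModels.Lens5RegularityCriterion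
open Summit.ResolutionOfSingularities.ResolutionOfSingularities.Theorems.RadicialJungCleanModels.Lens5ChartSurjection

namespace Summit.ResolutionOfSingularities.ResolutionOfSingularities.Theorems.RadicialJungCleanModels.Lens5TFrame

/-! ## §E∞ PORT 2′_∞ — the two-field M-side (F-02 over the SMALL field `k₀ = k^p`, `A` a `k`-model) -/

namespace TwoField

variable {k₀ : Type} [Field k₀] {k : Type} [Field k] {K : Type} [Field K]
  [Algebra k₀ k] [Algebra k₀ K] [Algebra k K] [IsScalarTower k₀ k K]

/-- `k` is algebraic over a subfield `k₀` over which every constant has its `p`-th power (`p > 0`). [folklore] -/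
theorem isAlgebraic_base {p : ℕ} (hp : 0 < p)
    (hFrob : ∀ c : k, ∃ c₀ : k₀, algebraMap k₀ K c₀ = algebraMap k K c ^ p) : Algebra.IsAlgebraic k₀ k := by
  refine ⟨fun c => ?_⟩
  obtain ⟨c₀, hc₀⟩ := hFrob c
  have hc : c ^ p = algebraMap k₀ k c₀ := by
    apply (algebraMap k K).injective
    rw [map_pow, ← IsScalarTower.algebraMap_apply k₀ k K, hc₀]
  exact IsIntegral.isAlgebraic (IsIntegral.of_pow hp (by rw [hc]; exact isIntegral_algebraMap))

/-- `trdeg_{k₀} K = trdeg_k K` for `k/k₀` algebraic as above. [folklore] -/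
theorem trdeg_eq_of_base {p : ℕ} (hp : 0 < p)
    (hFrob : ∀ c : k, ∃ c₀ : k₀, algebraMap k₀ K c₀ = algebraMap k K c ^ p) :
    Algebra.trdeg k₀ K = Algebra.trdeg k K := by
  haveI := isAlgebraic_base (K := K) hp hFrob
  haveI : FaithfulSMul k₀ k := (faithfulSMul_iff_algebraMap_injective k₀ k).mpr (algebraMap k₀ k).injective
  haveI : FaithfulSMul k K := (faithfulSMul_iff_algebraMap_injective k K).mpr (algebraMap k K).injective
  rw [← trdeg_add_eq k₀ k (A := K), trdeg_eq_zero (R := k₀) (A := k), zero_add]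

/-- `dim k₀[S] ≤ dim A` for a finite `S ⊆ K = Frac A`, `A` an affine `k`-domain, `k/k₀` algebraic as above
(`trdeg_{k₀} k₀[S] ≤ trdeg_{k₀} K = trdeg_k K = dim A`). [folklore] -/
theorem ringKrullDim_adjoin_preimage_le₂ {p : ℕ} (hp : 0 < p)
    (hFrob : ∀ c : k, ∃ c₀ : k₀, algebraMap k₀ K c₀ = algebraMap k K c ^ p)
    (A : Subalgebra k K) (hfg : A.FG) [IsFractionRing A K] {d : ℕ}
    (hdim : ringKrullDim A ≤ d) (S : Set K) (hSfin : S.Finite) :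
    ringKrullDim (Algebra.adjoin k₀ ((Subtype.val : IntermediateField.adjoin k₀ S → K) ⁻¹' S)) ≤ d := by
  have hBfg : (Algebra.adjoin k₀ ((Subtype.val : IntermediateField.adjoin k₀ S → K) ⁻¹' S)).FG := by
    refine Subalgebra.fg_def.mpr ⟨_, hSfin.preimage Subtype.val_injective.injOn, rfl⟩
  haveI : Algebra.FiniteType k₀ (Algebra.adjoin k₀ ((Subtype.val : IntermediateField.adjoin k₀ S → K) ⁻¹' S)) :=
    (Algebra.adjoin k₀ ((Subtype.val : IntermediateField.adjoin k₀ S → K) ⁻¹' S)).fg_iff_finiteType.mp hBfg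
  haveI : Algebra.FiniteType k A := A.fg_iff_finiteType.mp hfg
  obtain ⟨s, hsB, htrB⟩ := Literature.RingTheory.KrullDimension.exists_ringKrullDim_eq_and_trdeg_eq k₀
    (Algebra.adjoin k₀ ((Subtype.val : IntermediateField.adjoin k₀ S → K) ⁻¹' S))
  obtain ⟨n, hnA, htrA⟩ := Literature.RingTheory.KrullDimension.exists_ringKrullDim_eq_and_trdeg_eq k A
  haveI : FaithfulSMul k A := (faithfulSMul_iff_algebraMap_injective k A).mpr (algebraMap k A).injective
  haveI : FaithfulSMul A K := (faithfulSMul_iff_algebraMap_injective A K).mpr (IsFractionRing.injective A K)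
  haveI : Algebra.IsAlgebraic A K := IsLocalization.isAlgebraic K (nonZeroDivisors A)
  have htrK : Algebra.trdeg k K = (n : Cardinal) := by
    rw [← trdeg_add_eq k A (A := K), trdeg_eq_zero (R := A) (A := K), add_zero, htrA]
  have htrK₀ : Algebra.trdeg k₀ K = (n : Cardinal) := by rw [trdeg_eq_of_base hp hFrob, htrK]
  have hf : Function.Injective ((IsScalarTower.toAlgHom k₀ (IntermediateField.adjoin k₀ S) K).comp
      (Algebra.adjoin k₀ ((Subtype.val : IntermediateField.adjoin k₀ S → K) ⁻¹' S)).val) := by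
    intro x y hxy
    apply Subtype.ext
    apply Subtype.ext
    simpa using hxy
  have hle : Algebra.trdeg k₀ (Algebra.adjoin k₀ ((Subtype.val : IntermediateField.adjoin k₀ S → K) ⁻¹' S)) ≤
      Algebra.trdeg k₀ K := trdeg_le_of_injective _ hf
  rw [htrB, htrK₀] at hle
  have hsn : s ≤ n := by exact_mod_cast hle
  have hnd : n ≤ d := by
    rw [hnA] at hdim
    exact_mod_cast hdim
  rw [hsB]
  exact_mod_cast hsn.trans hnd

/-- **The M-side regular model over the SMALL field `k₀`** (F-02 via `.lu3` at `k₀`): for an affine `k`-model `A ⊆ O` of `K` of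
dimension `≤ 3` and a finite `S ⊆ O`, a finitely generated `k₀`-subalgebra `A' ⊇ k₀[S]` of `k₀(S)` inside `O` whose localisation at the
centre is regular. [folklore] -/
theorem exists_regular_model_subfield₂ {p : ℕ} (hp : 0 < p)
    (hFrob : ∀ c : k, ∃ c₀ : k₀, algebraMap k₀ K c₀ = algebraMap k K c ^ p)
    (hLU : LocalUniformization3 k₀) (O : ValuationSubring K) (A : Subalgebra k K)
    (hAO : A.toSubring ≤ O.toSubring) (hfg : A.FG) (hfr : IsFractionRing A K) (hdim : ringKrullDim A ≤ 3)
    (S : Set K) (hSfin : S.Finite) (hSO : ∀ s ∈ S, s ∈ O) :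
    ∃ (A' : Subalgebra k₀ (IntermediateField.adjoin k₀ S))
      (h : A'.toSubring ≤ (O.comap (algebraMap (IntermediateField.adjoin k₀ S) K)).toSubring),
      Algebra.adjoin k₀ ((Subtype.val : IntermediateField.adjoin k₀ S → K) ⁻¹' S) ≤ A' ∧ A'.FG ∧
        IsRegularLocalRing (Localization.AtPrime
          (centreIdeal A' (O.comap (algebraMap (IntermediateField.adjoin k₀ S) K)) h)) := by
  haveI := hfr
  have hk₀O : ∀ c : k₀, algebraMap k₀ K c ∈ O := fun c => by
    rw [IsScalarTower.algebraMap_apply k₀ k K]; exact hAO (A.algebraMap_mem _)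
  have hBO := TwistModel.adjoin_preimage_le_comap O hk₀O S hSO
  have hBfg : (Algebra.adjoin k₀ ((Subtype.val : IntermediateField.adjoin k₀ S → K) ⁻¹' S)).FG :=
    Subalgebra.fg_def.mpr ⟨_, hSfin.preimage Subtype.val_injective.injOn, rfl⟩
  have hBfr := TwistModel.isFractionRing_adjoin_preimage (k := k₀) S
  have hBdim := ringKrullDim_adjoin_preimage_le₂ hp hFrob A hfg (d := 3) (by exact_mod_cast hdim) S hSfin
  exact hLU (IntermediateField.adjoin k₀ S) (O.comap (algebraMap (IntermediateField.adjoin k₀ S) K)) _ hBO hBfg hBfr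
    (by exact_mod_cast hBdim)

omit [Algebra k₀ k] [IsScalarTower k₀ k K] in
/-- `a ∈ k[t] ⇒ a^p ∈ k₀[t^p]` (the coefficients' `p`-th powers lie in `k₀`). [folklore] -/
theorem pow_mem_adjoin_image_pow₂ (p : ℕ) [Fact p.Prime] [CharP K p]
    (hFrob : ∀ c : k, ∃ c₀ : k₀, algebraMap k₀ K c₀ = algebraMap k K c ^ p)
    (t : Set K) {a : K} (ha : a ∈ Algebra.adjoin k t) :
    a ^ p ∈ Algebra.adjoin k₀ ((fun x : K => x ^ p) '' t) := by
  induction ha using Algebra.adjoin_induction with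
  | mem x hx => exact Algebra.subset_adjoin ⟨x, hx, rfl⟩
  | algebraMap r =>
      obtain ⟨c₀, hc₀⟩ := hFrob r
      rw [← hc₀]
      exact Subalgebra.algebraMap_mem _ _
  | add x y _ _ hx hy => rw [add_pow_char]; exact add_mem hx hy
  | mul x y _ _ hx hy => rw [mul_pow]; exact mul_mem hx hy

omit [Algebra k₀ k] [IsScalarTower k₀ k K] in
/-- `K^p ⊆ k₀(S)` as soon as `S ⊇ t^p` for a generating set `t` of an affine `k`-model `A` with `Frac A = K`. [folklore] -/
theorem pow_mem_intermediateField_adjoin₂ (p : ℕ) [Fact p.Prime] [CharP K p]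
    (hFrob : ∀ c : k, ∃ c₀ : k₀, algebraMap k₀ K c₀ = algebraMap k K c ^ p)
    (A : Subalgebra k K) [IsFractionRing A K]
    (t : Set K) (ht : Algebra.adjoin k t = A) (S : Set K) (hS : (fun x : K => x ^ p) '' t ⊆ S) (z : K) :
    z ^ p ∈ IntermediateField.adjoin k₀ S := by
  obtain ⟨a, b, hb, rfl⟩ := IsFractionRing.div_surjective (A := A) z
  have hle : Algebra.adjoin k₀ ((fun x : K => x ^ p) '' t) ≤ (IntermediateField.adjoin k₀ S).toSubalgebra :=
    (Algebra.adjoin_mono hS).trans (IntermediateField.algebra_adjoin_le_adjoin k₀ S)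
  have ha' : ((a : K)) ^ p ∈ IntermediateField.adjoin k₀ S :=
    hle (pow_mem_adjoin_image_pow₂ p hFrob t (by rw [ht]; exact a.2))
  have hb' : ((b : K)) ^ p ∈ IntermediateField.adjoin k₀ S :=
    hle (pow_mem_adjoin_image_pow₂ p hFrob t (by rw [ht]; exact b.2))
  rw [show algebraMap A K a / algebraMap A K b = (a : K) / (b : K) from rfl, div_pow]
  exact div_mem ha' hb'

omit [Algebra k₀ k] [IsScalarTower k₀ k K] in
/-- The twist field over the small field: `k₀(t^p ∪ {g₀})` has underlying subfield `K^p(g₀) = Subfield.closure (range frob ∪ {g₀})`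
when `k₀` lands in `K^p`. [folklore] -/
theorem adjoin_twist_toSubfield_eq₂ (p : ℕ) [Fact p.Prime] [CharP K p]
    (hFrob : ∀ c : k, ∃ c₀ : k₀, algebraMap k₀ K c₀ = algebraMap k K c ^ p)
    (hk₀p : ∀ c₀ : k₀, ∃ d : K, algebraMap k₀ K c₀ = d ^ p)
    (A : Subalgebra k K) [IsFractionRing A K] (t : Set K) (ht : Algebra.adjoin k t = A) (g₀ : K) :
    (IntermediateField.adjoin k₀ ((fun x : K => x ^ p) '' t ∪ {g₀})).toSubfield =
      Subfield.closure (Set.range (frobenius K p) ∪ {g₀}) := by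
  rw [IntermediateField.adjoin_toSubfield]
  apply le_antisymm
  · apply Subfield.closure_le.mpr
    rintro x (hx | hx | hx)
    · obtain ⟨c₀, rfl⟩ := hx
      obtain ⟨d, hd⟩ := hk₀p c₀
      refine Subfield.subset_closure (Or.inl ⟨d, ?_⟩)
      rw [frobenius_def, hd]
    · obtain ⟨y, hy, rfl⟩ := hx
      exact Subfield.subset_closure (Or.inl ⟨y, frobenius_def ..⟩)
    · exact Subfield.subset_closure (Or.inr hx)
  · apply Subfield.closure_le.mpr
    rintro x (hx | hx)
    · obtain ⟨z, rfl⟩ := hx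
      have := pow_mem_intermediateField_adjoin₂ p hFrob A t ht ((fun x : K => x ^ p) '' t ∪ {g₀}) Set.subset_union_left z
      rw [frobenius_def]
      exact this
    · exact Subfield.subset_closure (Or.inr (Or.inr hx))

omit [Algebra k₀ k] [IsScalarTower k₀ k K] in
/-- **Closed centre on the M-side model over the small field.**  (hzd) for the affine `k`-model `A = k[t]`, and a `k₀`-subalgebra
`A' ⊆ O ∩ M` of a subfield `M` containing a `p`-th power of every generator: the centre of `O ∩ M` on `A'` is maximal (`k[A' ∪ t] ⊆ O`
contains `A` and is integral over `A'`, the constants of `k` having their `p`-th powers in `k₀ ⊆ A'`). [folklore] -/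
theorem centreIdeal_isMaximal_of_pow_generators₂ {p : ℕ} (hp : 0 < p)
    (hFrob : ∀ c : k, ∃ c₀ : k₀, algebraMap k₀ K c₀ = algebraMap k K c ^ p)
    (O : ValuationSubring K) (A : Subalgebra k K) (hAO : A.toSubring ≤ O.toSubring)
    (t : Set K) (ht : Algebra.adjoin k t = A)
    (hzd : ∀ (T : Subring K) (hT : T ≤ O.toSubring), A.toSubring ≤ T → (subringCentre T O hT).IsMaximal)
    (M : IntermediateField k₀ K) (A' : Subalgebra k₀ M) (h : A'.toSubring ≤ (O.comap (algebraMap M K)).toSubring)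
    (htA' : ∀ a ∈ t, ∃ y ∈ A', algebraMap M K y = a ^ p) :
    (centreIdeal A' (O.comap (algebraMap M K)) h).IsMaximal := by
  have hk : ∀ c : k, algebraMap k K c ∈ O := fun c => hAO (A.algebraMap_mem c)
  set f : M →ₐ[k₀] K := IsScalarTower.toAlgHom k₀ M K with hf_def
  have hf : Function.Injective f := (algebraMap M K).injective
  set B : Subalgebra k₀ K := A'.map f with hB_def
  have hBO : B.toSubring ≤ O.toSubring := by
    intro x hx
    obtain ⟨y, hy, rfl⟩ := Subalgebra.mem_map.mp hx
    exact (ValuationSubring.mem_comap.mp (h hy))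
  have hkB : ∀ c : k, algebraMap k K c ^ p ∈ B := by
    intro c
    obtain ⟨c₀, hc₀⟩ := hFrob c
    rw [← hc₀]
    exact B.algebraMap_mem c₀
  set C : Subalgebra k K := Algebra.adjoin k ((B : Set K) ∪ t) with hC_def
  have hCO : C.toSubring ≤ O.toSubring := by
    intro x hx
    rw [Subalgebra.mem_toSubring] at hx
    change x ∈ O
    induction hx using Algebra.adjoin_induction with
    | mem x hx =>
        rcases hx with hx | hx
        · exact hBO hx
        · exact hAO (by rw [← ht]; exact Algebra.subset_adjoin hx)
    | algebraMap r => exact hk r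
    | add x y _ _ hx hy => exact O.add_mem _ _ hx hy
    | mul x y _ _ hx hy => exact O.mul_mem _ _ hx hy
  have hAC : A ≤ C := by
    rw [← ht]
    exact Algebra.adjoin_mono Set.subset_union_right
  have hBC : B.toSubring ≤ C.toSubring := fun x hx => Algebra.subset_adjoin (Or.inl hx)
  have hmaxC : (subringCentre C.toSubring O hCO).IsMaximal := hzd C.toSubring hCO (fun x hx => hAC hx)
  letI algBC : Algebra B.toSubring C.toSubring := (Subring.inclusion hBC).toAlgebra
  haveI : Algebra.IsIntegral B.toSubring C.toSubring := by
    constructor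
    intro x
    let g : C.toSubring →ₐ[B.toSubring] K :=
      { toRingHom := C.toSubring.subtype
        commutes' := fun b => rfl }
    have hg : Function.Injective g := Subtype.val_injective
    rw [← isIntegral_algHom_iff g hg]
    change IsIntegral B.toSubring (x : K)
    let IC : Subalgebra k K :=
      { carrier := {a : K | IsIntegral B.toSubring a}
        mul_mem' := fun ha hb => ha.mul hb
        one_mem' := isIntegral_one
        add_mem' := fun ha hb => ha.add hb
        zero_mem' := isIntegral_zero
        algebraMap_mem' := fun r => IsIntegral.of_pow hp
          (isIntegral_algebraMap (R := B.toSubring) (A := K) (x := ⟨algebraMap k K r ^ p, hkB r⟩)) }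
    have hCle : C ≤ IC := by
      apply Algebra.adjoin_le
      rintro a (ha | ha)
      · change IsIntegral B.toSubring a
        exact isIntegral_algebraMap (R := B.toSubring) (A := K) (x := ⟨a, ha⟩)
      · change IsIntegral B.toSubring a
        obtain ⟨y, hy, hya⟩ := htA' a ha
        apply IsIntegral.of_pow hp
        rw [← hya]
        have hmem : algebraMap M K y ∈ B := Subalgebra.mem_map.mpr ⟨y, hy, rfl⟩
        exact isIntegral_algebraMap (R := B.toSubring) (A := K) (x := ⟨algebraMap M K y, hmem⟩)
    exact hCle x.2
  have hmaxB' : ((subringCentre C.toSubring O hCO).comap (algebraMap B.toSubring C.toSubring)).IsMaximal :=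
    Ideal.isMaximal_comap_of_isIntegral_of_isMaximal _
  have hcentreB : (subringCentre C.toSubring O hCO).comap (algebraMap B.toSubring C.toSubring) = centreIdeal B O hBO := by
    ext b
    rw [Ideal.mem_comap, mem_subringCentre_iff]
    change O.valuation (b : K) < 1 ↔ b ∈ centreIdeal B O hBO
    rw [centreIdeal, Ideal.mem_comap, ValuationSubring.valuation_lt_one_iff]
    rfl
  have hmaxB : (centreIdeal B O hBO).IsMaximal := hcentreB ▸ hmaxB'
  set e : A' ≃ₐ[k₀] B := A'.equivMapOfInjective f hf with he_def
  have hcentre : centreIdeal A' (O.comap (algebraMap M K)) h = (centreIdeal B O hBO).comap e.toRingEquiv.toRingHom := by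
    ext y
    rw [centreIdeal, Ideal.mem_comap, TwistModel.mem_maximalIdeal_comap_iff, Ideal.mem_comap, centreIdeal, Ideal.mem_comap,
      ValuationSubring.valuation_lt_one_iff, ValuationSubring.valuation_lt_one_iff]
    have hey : ((e y : B) : K) = algebraMap M K (y : M) := by
      rw [he_def, Subalgebra.coe_equivMapOfInjective_apply]
      rfl
    change O.valuation (algebraMap M K (y : M)) < 1 ↔ O.valuation ((e y : B) : K) < 1
    rw [hey]
  rw [hcentre]
  exact Ideal.comap_isMaximal_of_surjective _ e.surjective

/-- **Dimension of the M-side model over the small field**: `A' ⊇ k₀[S]` finitely generated inside `k₀(S)` with `K` algebraic over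
`k₀(S)` has `dim A' = dim A` (both equal `trdeg_k K = trdeg_{k₀} K`). [folklore] -/
theorem ringKrullDim_eq_of_adjoin_le₂ {p : ℕ} (hp : 0 < p)
    (hFrob : ∀ c : k, ∃ c₀ : k₀, algebraMap k₀ K c₀ = algebraMap k K c ^ p)
    (A : Subalgebra k K) (hAfg : A.FG) [IsFractionRing A K]
    (S : Set K) (halg : Algebra.IsAlgebraic (IntermediateField.adjoin k₀ S) K)
    (A' : Subalgebra k₀ (IntermediateField.adjoin k₀ S))
    (hSA' : Algebra.adjoin k₀ ((Subtype.val : IntermediateField.adjoin k₀ S → K) ⁻¹' S) ≤ A') (hA'fg : A'.FG) :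
    ringKrullDim A' = ringKrullDim A := by
  haveI : Algebra.FiniteType k₀ A' := A'.fg_iff_finiteType.mp hA'fg
  haveI : Algebra.FiniteType k A := A.fg_iff_finiteType.mp hAfg
  haveI hfr' : IsFractionRing A' (IntermediateField.adjoin k₀ S) := by
    refine IsFractionRing.of_field _ _ (fun z => ?_)
    obtain ⟨r, hr, s, hs, hz⟩ := IntermediateField.mem_adjoin_iff_div.mp z.2
    have hrM : r ∈ IntermediateField.adjoin k₀ S := IntermediateField.algebra_adjoin_le_adjoin k₀ S hr
    have hsM : s ∈ IntermediateField.adjoin k₀ S := IntermediateField.algebra_adjoin_le_adjoin k₀ S hs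
    refine ⟨⟨⟨r, hrM⟩, hSA' ((TwistModel.mem_adjoin_preimage_iff S _).mpr hr)⟩,
      ⟨⟨s, hsM⟩, hSA' ((TwistModel.mem_adjoin_preimage_iff S _).mpr hs)⟩, ?_⟩
    apply Subtype.ext
    simpa using hz
  obtain ⟨s, hsA', htrA'⟩ := Literature.RingTheory.KrullDimension.exists_ringKrullDim_eq_and_trdeg_eq k₀ A'
  obtain ⟨n, hnA, htrA⟩ := Literature.RingTheory.KrullDimension.exists_ringKrullDim_eq_and_trdeg_eq k A
  haveI : FaithfulSMul k A := (faithfulSMul_iff_algebraMap_injective k A).mpr (algebraMap k A).injective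
  haveI : FaithfulSMul A K := (faithfulSMul_iff_algebraMap_injective A K).mpr (IsFractionRing.injective A K)
  haveI : Algebra.IsAlgebraic A K := IsLocalization.isAlgebraic K (nonZeroDivisors A)
  haveI : FaithfulSMul k₀ A' := (faithfulSMul_iff_algebraMap_injective k₀ A').mpr (algebraMap k₀ A').injective
  haveI : FaithfulSMul A' (IntermediateField.adjoin k₀ S) :=
    (faithfulSMul_iff_algebraMap_injective A' _).mpr (IsFractionRing.injective A' (IntermediateField.adjoin k₀ S))
  haveI : Algebra.IsAlgebraic A' (IntermediateField.adjoin k₀ S) :=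
    IsLocalization.isAlgebraic (IntermediateField.adjoin k₀ S) (nonZeroDivisors A')
  haveI : FaithfulSMul (IntermediateField.adjoin k₀ S) K :=
    (faithfulSMul_iff_algebraMap_injective _ K).mpr (algebraMap (IntermediateField.adjoin k₀ S) K).injective
  haveI := halg
  have htrK : Algebra.trdeg k K = (n : Cardinal) := by
    rw [← trdeg_add_eq k A (A := K), trdeg_eq_zero (R := A) (A := K), add_zero, htrA]
  have htrK₀ : Algebra.trdeg k₀ K = (n : Cardinal) := by rw [trdeg_eq_of_base hp hFrob, htrK]
  have htrM : Algebra.trdeg k₀ (IntermediateField.adjoin k₀ S) = (n : Cardinal) := by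
    rw [← htrK₀, ← trdeg_add_eq k₀ (IntermediateField.adjoin k₀ S) (A := K),
      trdeg_eq_zero (R := IntermediateField.adjoin k₀ S) (A := K), add_zero]
  have htrA'' : Algebra.trdeg k₀ A' = (n : Cardinal) := by
    rw [← htrM, ← trdeg_add_eq k₀ A' (A := IntermediateField.adjoin k₀ S),
      trdeg_eq_zero (R := A') (A := IntermediateField.adjoin k₀ S), add_zero]
  rw [htrA'] at htrA''
  have hsn : s = n := by exact_mod_cast htrA''
  rw [hsA', hnA, hsn]

/-- **The three side obligations of F-32 for the M-side model over the small field**: closed centre, excellence, dimension `3`. [folklore] -/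
theorem model_side_obligations₂ (p : ℕ) [Fact p.Prime] [CharP K p]
    (hFrob : ∀ c : k, ∃ c₀ : k₀, algebraMap k₀ K c₀ = algebraMap k K c ^ p)
    (O : ValuationSubring K) (A : Subalgebra k K)
    (hAO : A.toSubring ≤ O.toSubring) (hAfg : A.FG) [IsFractionRing A K] (hdim : ringKrullDim A = 3)
    (t : Set K) (ht : Algebra.adjoin k t = A)
    (hzd : ∀ (T : Subring K) (hT : T ≤ O.toSubring), A.toSubring ≤ T → (subringCentre T O hT).IsMaximal)
    (S : Set K) (htS : (fun x : K => x ^ p) '' t ⊆ S)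
    (A' : Subalgebra k₀ (IntermediateField.adjoin k₀ S))
    (h : A'.toSubring ≤ (O.comap (algebraMap (IntermediateField.adjoin k₀ S) K)).toSubring)
    (hSA' : Algebra.adjoin k₀ ((Subtype.val : IntermediateField.adjoin k₀ S → K) ⁻¹' S) ≤ A') (hA'fg : A'.FG) :
    (centreIdeal A' (O.comap (algebraMap (IntermediateField.adjoin k₀ S) K)) h).IsMaximal ∧
      IsExcellentRing (Localization.AtPrime (centreIdeal A' (O.comap (algebraMap (IntermediateField.adjoin k₀ S) K)) h)) ∧
      ringKrullDim (Localization.AtPrime (centreIdeal A' (O.comap (algebraMap (IntermediateField.adjoin k₀ S) K)) h)) = 3 := by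
  have hp : 0 < p := (Fact.out : p.Prime).pos
  have htA' : ∀ a ∈ t, ∃ y ∈ A', algebraMap (IntermediateField.adjoin k₀ S) K y = a ^ p := by
    intro a ha
    have haS : a ^ p ∈ S := htS ⟨a, ha, rfl⟩
    refine ⟨⟨a ^ p, IntermediateField.subset_adjoin k₀ S haS⟩, hSA' (Algebra.subset_adjoin haS), rfl⟩
  have hmax := centreIdeal_isMaximal_of_pow_generators₂ hp hFrob O A hAO t ht hzd (IntermediateField.adjoin k₀ S) A' h htA'
  refine ⟨hmax, TwistModel.isExcellentRing_localization_centre _ _ A' h hA'fg, ?_⟩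
  haveI := hmax
  haveI : Algebra.FiniteType k₀ A' := A'.fg_iff_finiteType.mp hA'fg
  have halg : Algebra.IsAlgebraic (IntermediateField.adjoin k₀ S) K :=
    TwistModel.isAlgebraic_of_pow_mem _ hp (pow_mem_intermediateField_adjoin₂ p hFrob A t ht S htS)
  rw [ringKrullDim_localization_atPrime_eq_of_isMaximal k₀ (centreIdeal A' _ h),
    ringKrullDim_eq_of_adjoin_le₂ hp hFrob A hAfg S halg A' hSA' hA'fg, hdim]


end TwoField

end Summit.ResolutionOfSingularities.ResolutionOfSingularities.Theorems.RadicialJungCleanModels.Lens5TFrame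

end
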